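import Mathlib
import Literature.RepresentationTheory.FiniteGroups.IsotypicProjector
import Literature.RepresentationTheory.FiniteGroups.IrreducibleCharacters
import Literature.RepresentationTheory.FiniteGroups.CharacterDegrees

/-!
# The `H`-equivariant graded Neumann count
# (crux `LevelGradedCohnUmans.GradedDesignFamily`, stmt-MatrixMultiplication-7610; negative side,
# line `quadratic-extension-level-one-cell`, registered stub `equivariantCount_le`; leads c4/c5)

Let `H ≤ G` be a subgroup of a finite group, `J ≤ ℂ^G` a right-translation-invariant subspace,
and `Y, Z ⊆ G` non-empty sets such that `(H, Y, Z)` is `J`-separated in the sense of the route: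
for every target `(x₀, z₀) ∈ H × Z` some `f ∈ J` reads
`f(x⁻¹ y y'⁻¹ z) = [x = x₀ ∧ y = y' ∧ z = z₀]` on `H × Y × Y × Z`.  For an irreducible character
`σ` of `H` of degree `d = σ(1)` let `A_σ f (g) := ∑_{t ∈ H} (σ(1)/|H|) σ(t) f(t g)` be the
`σ`-isotypic averaging operator of `H` acting on `ℂ^G` by left translation.  Then

* `equivariantCount_le` —  `(|Y| + |Z| − 1) · d² ≤ dim span (A_σ J)`.

Summed over `σ` (the `A_σ` are orthogonal idempotents when `J` is also left-invariant) this is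
the graded Neumann count `|H| (|Y| + |Z| − 1) ≤ dim J` of the tree
(`Theorems/LevelTwoBeatsCubes/Negative/GradedNeumannCount.lean`, `packing_X` with `X = H`); the
point of the refinement is that a test space `J` poor in some isotypic type of `H` pays the
Neumann count in EVERY type separately (it is the lemma behind the standing ceiling `c ≤ 1/2`
of the line's open design stub, via the cuspidal rows of `SL₂(q) < GL₂(q²)`).

PROOF.  Fix `y₁ ∈ Y`, `z₁ ∈ Z` and the `N := |Z| + (|Y| − 1)` cosets `H z` (`z ∈ Z`) and
`H y y₁⁻¹ z₁` (`y ∈ Y ∖ y₁`), parametrised by `H × I`, `I := Z ⊔ (Y ∖ y₁)`, via the points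
`h⁻¹ z` and `h⁻¹ y y₁⁻¹ z₁`.  (1) Evaluation at these points maps `J` ONTO `ℂ^{H × I}`
(`map_eq_top_of_triangular`, the block-triangular argument of `packing_X`: the separator of
`(h₀, z₀)` is the coordinate vector of the point `h₀⁻¹ z₀`, and the right translate by
`z₁⁻¹ y₁ y₀⁻¹ z₁` of the separator of `(h₀, z₁)` is the coordinate vector of `h₀⁻¹ y₀ y₁⁻¹ z₁` on
the second block).  (2) The evaluation intertwines `A_σ` with the isotypic projector `P_σ` of the
COSET MODULE `ℂ^{H × I}`, `(s · u)(h, i) = u(h s, i)` (`exists_cosetRep`,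
`isotypicProj_cosetRep_funLeft`), so `P_σ(ℂ^{H × I}) = ev(A_σ J)` has dimension
`≤ dim span (A_σ J)`.  (3) `P_σ` is idempotent (`isotypicProj_comp_self`), so its rank is its
trace `σ(1) ⟨σ, χ⟩` (`trace_isotypicProj`, Mathlib `LinearMap.IsProj.trace`), and the character
`χ` of the coset module is `N` times the regular character (`cosetRep_character`), whence
`rk P_σ = N · σ(1)²` (`finrank_range_isotypicProj_cosetRep`).

Left-invariance of `J` (hypothesis `hl` of the registered signature) is what makes `A_σ J ⊆ J`
the `σ`-isotypic component of `J`; the inequality itself does not use it.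

Sorry-free; axioms `propext`, `Classical.choice`, `Quot.sound`.  No new definitions: the coset
module is produced by the existence lemma `exists_cosetRep` (a `Representation` together with its
pointwise formula) and every lemma about it is stated for any representation with that formula;
everything else is Mathlib (`LinearMap.funLeft`, `LinearMap.IsProj.trace`, `Pi.basisFun`) and the
tree's `IsotypicProjector.lean` / `IrreducibleCharacters.lean` / `CharacterDegrees.lean`.
-/

set_option linter.dupNamespace false

noncomputable section

open scoped BigOperators
open Module Literature.RepresentationTheory.FiniteGroups

namespace Summit.MatrixMultiplication.MatrixMultiplication.Theorems.GradedDesignFamily.Negative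

/-! ### Block-triangular surjectivity -/

/-- **Block-triangular surjectivity.** Let `ψ : M → ℂ^ι` be linear, `J ≤ M`, and `T` a set of
"target" indices. If for every target `a` some `f ∈ J` has `ψ f = δ_a`, and for every non-target
`s` some `f ∈ J` has `ψ f = δ_s` on the non-targets (arbitrary values on the targets), then
`ψ(J) = ℂ^ι`: `δ_s = ψ f − ∑_{a target} (ψ f)(a) δ_a`. (The evaluation count behind the tree's
`card_add_card_le_finrank`, as a surjectivity statement.) -/
theorem map_eq_top_of_triangular {M : Type*} [AddCommGroup M] [Module ℂ M] {ι : Type*}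
    [Fintype ι] [DecidableEq ι] (J : Submodule ℂ M) (ψ : M →ₗ[ℂ] (ι → ℂ)) (T : ι → Prop)
    (hT : ∀ a, T a → ∃ f ∈ J, ∀ j, ψ f j = if a = j then 1 else 0)
    (hS : ∀ s, ¬ T s → ∃ f ∈ J, ∀ j, ¬ T j → ψ f j = if s = j then 1 else 0) :
    J.map ψ = ⊤ := by
  classical
  set e : ι → ι → ℂ := fun i j => if i = j then 1 else 0 with he_def
  have heT : ∀ a, T a → e a ∈ J.map ψ := fun a ha => by
    obtain ⟨f, hf, hspec⟩ := hT a ha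
    exact Submodule.mem_map.2 ⟨f, hf, funext hspec⟩
  have he : ∀ i, e i ∈ J.map ψ := by
    intro i
    by_cases hi : T i
    · exact heT i hi
    obtain ⟨f, hf, hspec⟩ := hS i hi
    have key : e i = ψ f - ∑ a ∈ Finset.univ.filter T, ψ f a • e a := by
      funext j
      simp only [he_def, Pi.sub_apply, Finset.sum_apply, Pi.smul_apply, smul_eq_mul, mul_ite,
        mul_one, mul_zero, Finset.sum_ite_eq', Finset.mem_filter, Finset.mem_univ, true_and]
      by_cases hj : T j
      · have hij : i ≠ j := by
          rintro rfl
          exact hi hj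
        rw [if_neg hij, if_pos hj, sub_self]
      · rw [if_neg hj, sub_zero, hspec j hj]
    rw [key]
    exact Submodule.sub_mem _ (Submodule.mem_map_of_mem hf)
      (Submodule.sum_mem _ fun a ha => Submodule.smul_mem _ _ (heT a (Finset.mem_filter.1 ha).2))
  rw [eq_top_iff]
  rintro v -
  rw [pi_eq_sum_univ v]
  exact Submodule.sum_mem _ fun i _ => Submodule.smul_mem _ _ (he i)

/-! ### The coset module `ℂ^{K × I}` -/

section CosetModule

/-- The **coset module** of a group `K` with multiplicity set `I` exists as a representation:
`K` acting on `ℂ^{K × I}` by right translation of the first coordinate,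
`(s · u)(h, i) = u(h s, i)` — `|I|` copies of the regular representation; it is the space of
functions on a union of `|I|` cosets `K g_i` of `K` in an overgroup, in the coordinates
`u(h, i) = f(h⁻¹ g_i)`.  (Packaged as an existence statement with its pointwise formula, so that
this support file introduces no definition.) -/
theorem exists_cosetRep (K I : Type) [Group K] :
    ∃ ρ : Representation ℂ K (K × I → ℂ),
      ∀ (s : K) (u : K × I → ℂ) (p : K × I), ρ s u p = u (p.1 * s, p.2) := by
  refine ⟨{ toFun := fun s => { toFun := fun u p => u (p.1 * s, p.2), map_add' := fun _ _ => rfl,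
                                map_smul' := fun _ _ => rfl },
            map_one' := ?_,
            map_mul' := fun s t => ?_ }, fun _ _ _ => rfl⟩
  · refine LinearMap.ext fun u => funext fun p => ?_
    simp
  · refine LinearMap.ext fun u => funext fun p => ?_
    simp [mul_assoc]

variable {K I : Type} [Group K] [Fintype K] [Fintype I] {ρ : Representation ℂ K (K × I → ℂ)}

/-- **The character of the coset module** is `|I|` times the regular character:
`χ(s) = [s = 1] · |K × I|` (in the basis of coordinate vectors, `u ↦ u(· s, ·)` is a permutation
matrix without fixed points unless `s = 1`; cf. the tree's `character_leftRegular`). -/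
theorem cosetRep_character
    (hρ : ∀ (s : K) (u : K × I → ℂ) (p : K × I), ρ s u p = u (p.1 * s, p.2)) [DecidableEq K]
    (s : K) : ρ.character s = if s = 1 then (Fintype.card (K × I) : ℂ) else 0 := by
  classical
  rw [Representation.character, LinearMap.trace_eq_matrix_trace ℂ (Pi.basisFun ℂ (K × I)),
    Matrix.trace]
  simp only [Matrix.diag_apply, LinearMap.toMatrix_apply, Pi.basisFun_apply, Pi.basisFun_repr,
    hρ]
  by_cases hs : s = 1
  · subst hs
    simp
  · rw [if_neg hs]
    refine Finset.sum_eq_zero fun p _ => Pi.single_eq_of_ne ?_ _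
    intro h
    have h1 : p.1 * s = p.1 := congrArg Prod.fst h
    exact hs (mul_eq_left.1 h1)

/-- `⟨χ, χ_coset⟩ = χ(1) · |I|` for every function `χ` on `K` (only `s = 1` contributes to the
scalar product with the character of the coset module). -/
theorem classInner_cosetRep_character
    (hρ : ∀ (s : K) (u : K × I → ℂ) (p : K × I), ρ s u p = u (p.1 * s, p.2)) (χ : K → ℂ) :
    classInner χ ρ.character = χ 1 * Fintype.card I := by
  classical
  have hK : (Fintype.card K : ℂ) ≠ 0 := Nat.cast_ne_zero.2 Fintype.card_ne_zero
  have h : ∀ s : K, χ s * ρ.character s⁻¹ =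
      if s = 1 then χ 1 * ((Fintype.card K : ℂ) * Fintype.card I) else 0 := by
    intro s
    by_cases hs : s = 1
    · subst hs
      rw [inv_one, cosetRep_character hρ, if_pos rfl, if_pos rfl, Fintype.card_prod,
        Nat.cast_mul]
    · rw [cosetRep_character hρ, if_neg (inv_ne_one.2 hs), if_neg hs, mul_zero]
  rw [classInner_apply, Finset.sum_congr rfl fun s _ => h s, Finset.sum_ite_eq']
  simp only [Finset.mem_univ, if_true]
  rw [mul_left_comm (χ 1), inv_mul_cancel_left₀ hK]

/-- **Rank of an isotypic projector on the coset module**: for an irreducible character `χ` of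
`K`, `rk P_χ(ℂ^{K × I}) = χ(1)² · |I|` — `P_χ` is idempotent (`isotypicProj_comp_self`), so its
rank is its trace `χ(1) ⟨χ, χ_coset⟩ = χ(1) · χ(1) |I|` (`trace_isotypicProj`,
`LinearMap.IsProj.trace`); this is "the regular representation contains `χ` exactly `χ(1)`
times", `|I|` times over. -/
theorem finrank_range_isotypicProj_cosetRep
    (hρ : ∀ (s : K) (u : K × I → ℂ) (p : K × I), ρ s u p = u (p.1 * s, p.2)) {χ : K → ℂ}
    (hχ : IsIrrChar K χ) :
    (finrank ℂ (LinearMap.range (isotypicProj ρ χ)) : ℂ) = χ 1 * χ 1 * Fintype.card I := by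
  have hidem : IsIdempotentElem (isotypicProj ρ χ) := by
    change isotypicProj ρ χ * isotypicProj ρ χ = _
    rw [Module.End.mul_eq_comp, isotypicProj_comp_self _ hχ]
  rw [← (LinearMap.IsIdempotentElem.isProj_range _ hidem).trace, trace_isotypicProj,
    classInner_cosetRep_character hρ, mul_assoc]

end CosetModule

/-! ### Naturality of the averaging operator -/

/-- **Naturality.** Let `H ≤ G` and let `π : H × I → G` be a family of points with
`π(h t⁻¹, i) = t · π(h, i)` (e.g. `π(h, i) = h⁻¹ g_i`, the cosets `H g_i` read backwards).
Then evaluation at `π` (`LinearMap.funLeft`) carries the averaging operator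
`A_σ f (g) = ∑_{t ∈ H} (σ(1)/|H|) σ(t) f(t g)` on `ℂ^G` to the isotypic projector `P_σ` of the
coset module: `P_σ (f ∘ π) = (A_σ f) ∘ π`. -/
theorem isotypicProj_cosetRep_funLeft {G : Type} [Group G] [Fintype G] (H : Subgroup G)
    [DecidablePred (· ∈ H)] {I : Type} {ρ : Representation ℂ ↥H (↥H × I → ℂ)}
    (hρ : ∀ (s : ↥H) (u : ↥H × I → ℂ) (p : ↥H × I), ρ s u p = u (p.1 * s, p.2))
    (π : ↥H × I → G) (hπ : ∀ (t : ↥H) (p : ↥H × I), π (p.1 * t⁻¹, p.2) = (t : G) * π p)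
    (σ : ↥H → ℂ) (f : G → ℂ) :
    isotypicProj ρ σ (LinearMap.funLeft ℂ ℂ π f) =
      LinearMap.funLeft ℂ ℂ π
        (fun g : G => ∑ t : ↥H, σ 1 / (Fintype.card ↥H : ℂ) * σ t * f ((t : G) * g)) := by
  funext p
  simp only [isotypicProj_apply, Finset.sum_apply, Pi.smul_apply, smul_eq_mul, hρ,
    LinearMap.funLeft_apply, hπ]

/-! ### The count -/

/-- **The `H`-equivariant graded Neumann count.** Let `H ≤ G` (finite), `J ≤ ℂ^G` left- and
right-translation invariant, `Y, Z ⊆ G` non-empty, and suppose `(H, Y, Z)` is `J`-separated: for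
every `x₀ ∈ H`, `z₀ ∈ Z` some `f ∈ J` has `f(x⁻¹ y y'⁻¹ z) = [x = x₀ ∧ y = y' ∧ z = z₀]` for all
`x ∈ H`, `y, y' ∈ Y`, `z ∈ Z`. Then for every irreducible character `σ` of `H`,
`(|Y| + |Z| − 1) · σ(1)² ≤ dim span {A_σ f : f ∈ J}`, where
`A_σ f (g) = ∑_{t ∈ H} (σ(1)/|H|) σ(t) f(t g)` is the `σ`-isotypic averaging operator.
(Evaluation on the `|Y| + |Z| − 1` cosets `H z`, `H y y₁⁻¹ z₁` maps `J` onto the coset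
module, equivariantly; the `σ`-isotypic projector of the coset module has rank
`(|Y| + |Z| − 1) σ(1)²` and its range is the image of `A_σ J`. Left-invariance is not used.) -/
theorem equivariantCount_le {G : Type} [Group G] [Fintype G] [DecidableEq G]
    (H : Subgroup G) [DecidablePred (· ∈ H)] (J : Submodule ℂ (G → ℂ))
    (hl : ∀ f ∈ J, ∀ a : G, (fun g => f (a * g)) ∈ J)
    (hr : ∀ f ∈ J, ∀ b : G, (fun g => f (g * b)) ∈ J)
    (Y Z : Finset G) (hY : Y.Nonempty) (hZ : Z.Nonempty)
    (hsep : ∀ x₀ : G, x₀ ∈ H → ∀ z₀ ∈ Z, ∃ f ∈ J, ∀ x : G, x ∈ H → ∀ y ∈ Y, ∀ y' ∈ Y, ∀ z ∈ Z,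
      (x = x₀ ∧ y = y' ∧ z = z₀ → f (x⁻¹ * y * y'⁻¹ * z) = 1) ∧
      (¬ (x = x₀ ∧ y = y' ∧ z = z₀) → f (x⁻¹ * y * y'⁻¹ * z) = 0))
    (σ : ↥H → ℂ) (hσ : Literature.RepresentationTheory.FiniteGroups.IsIrrChar ↥H σ) :
    ((Y.card + Z.card - 1 : ℕ) : ℝ) * (σ 1).re ^ 2 ≤
      (Module.finrank ℂ (Submodule.span ℂ ((fun f : G → ℂ => fun g : G =>
        ∑ t : ↥H, σ 1 / (Fintype.card ↥H : ℂ) * σ t * f ((t : G) * g)) ''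
          (J : Set (G → ℂ)))) : ℝ) := by
  -- left-invariance `hl` is part of the registered signature (it makes `A_σ J ⊆ J` the
  -- `σ`-isotypic part of `J`), but the bound on `dim span (A_σ J)` does not need it
  have _ := hl
  obtain ⟨y₁, hy₁⟩ := hY
  obtain ⟨z₁, hz₁⟩ := hZ
  -- the points `h⁻¹ z` (`z ∈ Z`) and `h⁻¹ y y₁⁻¹ z₁` (`y ∈ Y ∖ y₁`) of the `|Z| + (|Y| - 1)` cosets
  let π : ↥H × (↥Z ⊕ ↥(Y.erase y₁)) → G := fun p =>
    (p.1 : G)⁻¹ *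
      Sum.elim (fun z : ↥Z => (z : G)) (fun y : ↥(Y.erase y₁) => (y : G) * y₁⁻¹ * z₁) p.2
  have hπ : ∀ (t : ↥H) (p : ↥H × (↥Z ⊕ ↥(Y.erase y₁))), π (p.1 * t⁻¹, p.2) = (t : G) * π p := by
    intro t p
    simp only [π, Subgroup.coe_mul, Subgroup.coe_inv, mul_inv_rev, inv_inv, mul_assoc]
  -- the coset module `ℂ^{H × I}`, `I := Z ⊔ (Y ∖ y₁)`
  obtain ⟨ρ, hρ⟩ := exists_cosetRep ↥H (↥Z ⊕ ↥(Y.erase y₁))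
  -- (1) evaluation at these points maps `J` onto the coset module `ℂ^{H × I}`
  have htop : J.map (LinearMap.funLeft ℂ ℂ π) = ⊤ := by
    refine map_eq_top_of_triangular J (LinearMap.funLeft ℂ ℂ π) (fun p => ∃ z, p.2 = Sum.inl z)
      ?_ ?_
    · rintro ⟨h₀, i₀⟩ ⟨z₀, hi₀⟩
      dsimp only at hi₀
      subst hi₀
      obtain ⟨f, hf, hspec⟩ := hsep h₀ h₀.2 z₀ z₀.2
      refine ⟨f, hf, ?_⟩
      rintro ⟨h, z | y⟩
      · -- target point `h⁻¹ z`: the separator of `(h₀, z₀)` reads `[h = h₀ ∧ z = z₀]`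
        have h1 := hspec h h.2 y₁ hy₁ y₁ hy₁ z z.2
        rw [mul_inv_cancel_right] at h1
        simp only [LinearMap.funLeft_apply, π, Sum.elim_inl, Prod.mk.injEq, Sum.inl.injEq]
        by_cases hc : h₀ = h ∧ z₀ = z
        · rw [if_pos hc]
          exact h1.1 ⟨by rw [hc.1], rfl, by rw [hc.2]⟩
        · rw [if_neg hc]
          refine h1.2 ?_
          rintro ⟨hh, -, hz⟩
          exact hc ⟨(Subtype.ext hh).symm, (Subtype.ext hz).symm⟩
      · -- slab point `h⁻¹ y y₁⁻¹ z₁` with `y ≠ y₁`: the separator vanishes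
        have hy := Finset.mem_erase.1 y.2
        have h1 := hspec h h.2 y hy.2 y₁ hy₁ z₁ hz₁
        have e : (h : G)⁻¹ * ((y : G) * y₁⁻¹ * z₁) = (h : G)⁻¹ * y * y₁⁻¹ * z₁ := by
          simp only [mul_assoc]
        rw [if_neg (by simp)]
        simp only [LinearMap.funLeft_apply, π, Sum.elim_inr]
        rw [e]
        refine h1.2 ?_
        rintro ⟨-, hyy, -⟩
        exact hy.1 hyy
    · rintro ⟨h₀, i₀⟩ hi₀
      obtain ⟨y₀, rfl⟩ : ∃ y₀, i₀ = Sum.inr y₀ := by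
        cases i₀ with
        | inl z => exact absurd ⟨z, rfl⟩ hi₀
        | inr y => exact ⟨y, rfl⟩
      have hy₀ := Finset.mem_erase.1 y₀.2
      -- the right translate by `z₁⁻¹ y₁ y₀⁻¹ z₁` of the separator of `(h₀, z₁)`
      obtain ⟨f, hf, hspec⟩ := hsep h₀ h₀.2 z₁ hz₁
      refine ⟨fun g => f (g * (z₁⁻¹ * y₁ * (y₀ : G)⁻¹ * z₁)), hr f hf _, ?_⟩
      rintro ⟨h, z | y⟩ hj
      · exact absurd ⟨z, rfl⟩ hj
      · have hy := Finset.mem_erase.1 y.2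
        have h1 := hspec h h.2 y hy.2 y₀ hy₀.2 z₁ hz₁
        have e : (h : G)⁻¹ * ((y : G) * y₁⁻¹ * z₁) * (z₁⁻¹ * y₁ * (y₀ : G)⁻¹ * z₁) =
            (h : G)⁻¹ * y * (y₀ : G)⁻¹ * z₁ := by
          group
        simp only [LinearMap.funLeft_apply, π, Sum.elim_inr, Prod.mk.injEq, Sum.inr.injEq]
        rw [e]
        by_cases hc : h₀ = h ∧ y₀ = y
        · rw [if_pos hc]
          exact h1.1 ⟨by rw [hc.1], by rw [hc.2], rfl⟩
        · rw [if_neg hc]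
          refine h1.2 ?_
          rintro ⟨hh, hyy, -⟩
          exact hc ⟨(Subtype.ext hh).symm, (Subtype.ext hyy).symm⟩
  -- (2) naturality: the range of `P_σ` on the coset module lies in the image of `span (A_σ J)`
  have hrange : LinearMap.range (isotypicProj ρ σ) ≤
      (Submodule.span ℂ ((fun f : G → ℂ => fun g : G =>
        ∑ t : ↥H, σ 1 / (Fintype.card ↥H : ℂ) * σ t * f ((t : G) * g)) ''
          (J : Set (G → ℂ)))).map (LinearMap.funLeft ℂ ℂ π) := by
    rintro _ ⟨v, rfl⟩
    have hv : v ∈ J.map (LinearMap.funLeft ℂ ℂ π) := by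
      rw [htop]
      exact Submodule.mem_top
    obtain ⟨f, hf, rfl⟩ := Submodule.mem_map.1 hv
    rw [isotypicProj_cosetRep_funLeft H hρ π hπ σ f]
    exact Submodule.mem_map_of_mem (Submodule.subset_span ⟨f, hf, rfl⟩)
  -- (3) the rank of `P_σ` on the coset module is `(|Z| + (|Y| - 1)) · d²`
  obtain ⟨d, -, hd⟩ := IsIrrChar.exists_apply_one hσ
  have hrank : (finrank ℂ (LinearMap.range (isotypicProj ρ σ)) : ℂ) =
      (((Z.card + (Y.card - 1)) * d ^ 2 : ℕ) : ℂ) := by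
    rw [finrank_range_isotypicProj_cosetRep hρ hσ, hd]
    simp only [Fintype.card_sum, Fintype.card_coe, Finset.card_erase_of_mem hy₁]
    push_cast
    ring
  have hle : (Z.card + (Y.card - 1)) * d ^ 2 ≤
      finrank ℂ (Submodule.span ℂ ((fun f : G → ℂ => fun g : G =>
        ∑ t : ↥H, σ 1 / (Fintype.card ↥H : ℂ) * σ t * f ((t : G) * g)) '' (J : Set (G → ℂ)))) := by
    rw [← Nat.cast_injective hrank]
    exact (Submodule.finrank_mono hrange).trans (Submodule.finrank_map_le _ _)
  -- (4) assemble: `|Y| + |Z| - 1 = |Z| + (|Y| - 1)` and `Re σ(1) = d`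
  have hcard : Y.card + Z.card - 1 = Z.card + (Y.card - 1) := by
    have := Finset.card_pos.2 ⟨y₁, hy₁⟩
    omega
  have hre : (σ 1).re = d := by
    rw [hd, Complex.natCast_re]
  rw [hcard, hre]
  exact_mod_cast hle

end Summit.MatrixMultiplication.MatrixMultiplication.Theorems.GradedDesignFamily.Negative

end
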